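import Summits.Schanuel.Schanuel.Theorems.SoloInformedX193Service

/-!
# X193 kernel line, file F5: localisation and the entry-fare dichotomy

Solo seat `solo-Schanuel-informed`, X193 kernel programme (design note
`work/s213/X193-KERNEL-DESIGN.md`, Amendments A2/A3; pen proof `work/s194/X193-pen.md`
§4 (loc) and §5; files F1 = `SoloInformedX193Inequalities`, F2 = `SoloInformedX193Service`;
the window and payment bounds of §5 (b')(1),(2) and Cor (iii) are in file F5b =
`SoloInformedX193Window`).

Everything here is about ONE piece `P` of an abstract service structure
`D : SoloServiceData ι` (file F2) that is alive at a level `n` and main-serves some active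
columns `k` (`λ n^ν ≤ m_P(n) d_P^k`) at which its bank is capped (`d_P^k ≤ cap_n(P)`):

* `loc_level`, `entry_gt_of_capped` (pen §4 (loc)): `λ n^ν ≤ 2 n L_P + B n² log (n+2)`,
  hence the current life of `P` entered AFTER every level `E ≥ n₀` with
  `2 n (E^β + b₁ E) + B n² log (n+2) < λ n^ν`; `cap_le_entry`:
  `cap_n(P) ≤ 2 e (e^β + b₁ e) + B e² log (n+2)` in terms of the entry level `e`;
* the entry-fare dichotomy of pen §5 at the level `ℓ = e - 1` before the entry `e`, where
  `P` is not alive and the entry law (L1) applies to the assigned columns `S ⊆ [1, ℓ^σ]`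
  (`entryLaw_pred_entry`; explicit error `entry_error_le`, `entry_error_le'`:
  `T ≤ (1 + 16 A₂ ℓ^{2-β} log (ℓ+2)) C_P(ℓ)` for the (L1) right-hand side `T`):
  `shallow_card_bound` (case (a'): `|S| λ n^ν ≤ m T`), `supply_bound` (case (b'):
  `|S| ℓ^ν ≤ T`, the per-level supply `s ≤ s^H_P`), and `deep_of_cheap`: a CHEAP server
  (`m C_P(n) ≤ η n^ν |S|`, i.e. fare `≤ η`, with `η t < λ` and `T ≤ t C_P(n)`) is in
  case (b').

All absorptions of error terms ("`t = 1 + ε`", "`e` large") are hypotheses here; they are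
discharged once, eventually in the level, by the counting file.  No definitions, no sorries.
-/

namespace Summit.Schanuel.Schanuel.Theorems

open Finset

namespace SoloServiceData

variable {ι : Type*} (D : SoloServiceData ι)

/-! ### Budget consequences for one alive piece -/

/-- Under (Bud), `m_P(n) g_P ≤ n` for a piece alive at a level `n ≥ n₀`. -/
theorem mult_mul_deg_le_level {β b₁ : ℝ} {n₀ : ℕ} (hB : D ∈ budgetLaw β b₁ n₀) {P : ι}
    {n : ℕ} (hn : n₀ ≤ n) (h : P ∈ D.alive n) : (D.mult P n : ℝ) * D.deg P ≤ n := by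
  have h1 := (hB n hn).1
  have hsingle : (D.mult P n : ℝ) * D.deg P ≤
      ∑ Q ∈ D.alive n, (D.mult Q n : ℝ) * D.deg Q := by
    apply Finset.single_le_sum (f := fun Q => (D.mult Q n : ℝ) * D.deg Q) _ h
    intro Q _
    positivity
  exact hsingle.trans h1

/-- Under (WF) and (Bud), `m_P(n) ≤ n` for a piece alive at a level `n ≥ n₀`. -/
theorem mult_le_level {c₀ β b₁ : ℝ} {n₀ : ℕ} (hW : D ∈ wellFormed c₀)
    (hB : D ∈ budgetLaw β b₁ n₀) {P : ι} {n : ℕ} (hn : n₀ ≤ n) (h : P ∈ D.alive n) :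
    (D.mult P n : ℝ) ≤ n := by
  have h1 := D.mult_mul_deg_le_level hB hn h
  have hg : (1 : ℝ) ≤ D.deg P := by exact_mod_cast hW.1 P
  have hm : (0 : ℝ) ≤ D.mult P n := by positivity
  nlinarith

/-- Under (WF) and (Bud), the log-height of a piece alive at a level `ℓ ≥ n₀` is at most
`ℓ^β + b₁ ℓ` (one term of the Mahler budget). -/
theorem logHt_le_of_alive {c₀ β b₁ : ℝ} {n₀ : ℕ} (hW : D ∈ wellFormed c₀)
    (hB : D ∈ budgetLaw β b₁ n₀) {P : ι} {ℓ : ℕ} (hℓ : n₀ ≤ ℓ) (h : P ∈ D.alive ℓ) :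
    D.logHt P ≤ (ℓ : ℝ) ^ β + b₁ * ℓ := by
  have h2 := (hB ℓ hℓ).2
  have hsingle : (D.mult P ℓ : ℝ) * D.logHt P ≤
      ∑ Q ∈ D.alive ℓ, (D.mult Q ℓ : ℝ) * D.logHt Q := by
    apply Finset.single_le_sum (f := fun Q => (D.mult Q ℓ : ℝ) * D.logHt Q) _ h
    intro Q _
    exact mul_nonneg (by positivity) (hW.2.1 Q)
  have hm : (1 : ℝ) ≤ D.mult P ℓ := D.one_le_mult_of_alive hW h
  have hL : 0 ≤ D.logHt P := hW.2.1 P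
  nlinarith

/-- `P` alive at `n` is alive at its entry level `entry P n`. -/
theorem alive_entry (P : ι) {n : ℕ} (hP : P ∈ D.alive n) : P ∈ D.alive (D.entry P n) :=
  D.alive_of_entry_le P n _ le_rfl ((D.entry_le_iff_alive P n).mpr hP)

/-- Degree bound at the entry level: `g_P ≤ e` when `e = entry P n ≥ n₀`. -/
theorem deg_le_entry {c₀ β b₁ : ℝ} {n₀ : ℕ} (hW : D ∈ wellFormed c₀)
    (hB : D ∈ budgetLaw β b₁ n₀) {P : ι} {n : ℕ} (hP : P ∈ D.alive n)
    (he : n₀ ≤ D.entry P n) : (D.deg P : ℝ) ≤ D.entry P n :=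
  D.deg_le_level hW hB he (D.alive_entry P hP)

/-- Height bound at the entry level: `L_P ≤ e^β + b₁ e` when `e = entry P n ≥ n₀`
(pen §4: "(Bud) at the entry level"). -/
theorem logHt_le_entry {c₀ β b₁ : ℝ} {n₀ : ℕ} (hW : D ∈ wellFormed c₀)
    (hB : D ∈ budgetLaw β b₁ n₀) {P : ι} {n : ℕ} (hP : P ∈ D.alive n)
    (he : n₀ ≤ D.entry P n) :
    D.logHt P ≤ (D.entry P n : ℝ) ^ β + b₁ * (D.entry P n) :=
  D.logHt_le_of_alive hW hB he (D.alive_entry P hP)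

/-! ### Pen §4 (loc): a capped main server has large height, hence a late entry -/

/-- (loc), level form (pen §4; DESIGN A2 (i)): if `P`, alive at `n ≥ n₀`, supplies
`λ n^ν ≤ m_P(n) d_P^k` at a column where `d_P^k ≤ cap_n(P) = 2 g L + B g² log (n+2)`,
then `λ n^ν ≤ 2 n L_P + B n² log (n+2)` (use `m g ≤ n` and `g ≤ n`). -/
theorem loc_level {c₀ β b₁ : ℝ} {n₀ : ℕ} (hW : D ∈ wellFormed c₀)
    (hB : D ∈ budgetLaw β b₁ n₀) {B : ℝ} (hBnn : 0 ≤ B) {P : ι} {n : ℕ} (hn : n₀ ≤ n)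
    (hP : P ∈ D.alive n) {k : ℕ} {lam ν : ℝ}
    (hsup : lam * (n : ℝ) ^ ν ≤ D.mult P n * D.bank P k)
    (hcap : D.bank P k ≤ D.cap B P n) :
    lam * (n : ℝ) ^ ν ≤ 2 * n * D.logHt P + B * (n : ℝ) ^ 2 * Real.log ((n : ℝ) + 2) := by
  have hm : (0 : ℝ) ≤ D.mult P n := by positivity
  have hmg : (D.mult P n : ℝ) * D.deg P ≤ n := D.mult_mul_deg_le_level hB hn hP
  have hg : (D.deg P : ℝ) ≤ n := D.deg_le_level hW hB hn hP
  have hg0 : (0 : ℝ) ≤ D.deg P := by positivity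
  have hL : 0 ≤ D.logHt P := hW.2.1 P
  have hn0 : (0 : ℝ) ≤ n := by positivity
  have hlog : 0 ≤ Real.log ((n : ℝ) + 2) := Real.log_nonneg (by linarith)
  have h1 : ((D.mult P n : ℝ) * D.deg P) * D.deg P ≤ (n : ℝ) * n :=
    mul_le_mul hmg hg hg0 hn0
  have h2 : ((D.mult P n : ℝ) * D.deg P) * D.logHt P ≤ n * D.logHt P :=
    mul_le_mul_of_nonneg_right hmg hL
  have h3 : B * (((D.mult P n : ℝ) * D.deg P) * D.deg P) * Real.log ((n : ℝ) + 2) ≤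
      B * ((n : ℝ) * n) * Real.log ((n : ℝ) + 2) :=
    mul_le_mul_of_nonneg_right (mul_le_mul_of_nonneg_left h1 hBnn) hlog
  calc lam * (n : ℝ) ^ ν ≤ D.mult P n * D.bank P k := hsup
    _ ≤ D.mult P n * D.cap B P n := mul_le_mul_of_nonneg_left hcap hm
    _ = 2 * (((D.mult P n : ℝ) * D.deg P) * D.logHt P) +
          B * (((D.mult P n : ℝ) * D.deg P) * D.deg P) * Real.log ((n : ℝ) + 2) := by
        unfold cap; ring
    _ ≤ 2 * (n * D.logHt P) + B * ((n : ℝ) * n) * Real.log ((n : ℝ) + 2) := by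
        linarith
    _ = 2 * n * D.logHt P + B * (n : ℝ) ^ 2 * Real.log ((n : ℝ) + 2) := by ring

/-- (loc), entry form (pen §4): under the hypotheses of `loc_level`, with `b₁, β, B ≥ 0`,
the current life of `P` entered AFTER every level `E ≥ n₀` such that
`2 n (E^β + b₁ E) + B n² log (n+2) < λ n^ν`.  (In the count, `E ≍ n^{(ν-1)/β}`.) -/
theorem entry_gt_of_capped {c₀ β b₁ : ℝ} {n₀ : ℕ} (hW : D ∈ wellFormed c₀)
    (hB : D ∈ budgetLaw β b₁ n₀) (hb₁ : 0 ≤ b₁) (hβ : 0 ≤ β) {B : ℝ} (hBnn : 0 ≤ B)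
    {P : ι} {n : ℕ} (hn : n₀ ≤ n) (hP : P ∈ D.alive n) {k : ℕ} {lam ν : ℝ}
    (hsup : lam * (n : ℝ) ^ ν ≤ D.mult P n * D.bank P k)
    (hcap : D.bank P k ≤ D.cap B P n) {E : ℕ} (hE : n₀ ≤ E)
    (hbig : 2 * n * ((E : ℝ) ^ β + b₁ * E) + B * (n : ℝ) ^ 2 * Real.log ((n : ℝ) + 2) <
      lam * (n : ℝ) ^ ν) :
    E < D.entry P n := by
  by_contra hle
  push Not at hle
  set ℓ := max (D.entry P n) n₀ with hℓdef
  have hℓn : ℓ ≤ n := max_le ((D.entry_le_iff_alive P n).mpr hP) hn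
  have hℓ0 : n₀ ≤ ℓ := le_max_right _ _
  have hPℓ : P ∈ D.alive ℓ := D.alive_of_entry_le P n ℓ (le_max_left _ _) hℓn
  have hLℓ : D.logHt P ≤ (ℓ : ℝ) ^ β + b₁ * ℓ := D.logHt_le_of_alive hW hB hℓ0 hPℓ
  have hℓE : (ℓ : ℝ) ≤ E := by exact_mod_cast max_le hle hE
  have hpow : (ℓ : ℝ) ^ β ≤ (E : ℝ) ^ β := Real.rpow_le_rpow (by positivity) hℓE hβ
  have hloc := D.loc_level hW hB hBnn hn hP hsup hcap
  have hn0 : (0 : ℝ) ≤ n := by positivity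
  have hLE : D.logHt P ≤ (E : ℝ) ^ β + b₁ * E := by
    nlinarith [mul_le_mul_of_nonneg_left hℓE hb₁]
  nlinarith [mul_le_mul_of_nonneg_left hLE (by positivity : (0 : ℝ) ≤ 2 * n)]

/-- The cap of a piece alive at `n` in terms of its entry level `e ≥ n₀` (pen §5 (b')(2):
"`g_P ≤ e`, `L_P ≤ e^β + e`"): `cap_n(P) ≤ 2 e (e^β + b₁ e) + B e² log (n+2)`. -/
theorem cap_le_entry {c₀ β b₁ : ℝ} {n₀ : ℕ} (hW : D ∈ wellFormed c₀)
    (hB : D ∈ budgetLaw β b₁ n₀) {B : ℝ} (hBnn : 0 ≤ B) {P : ι} {n : ℕ}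
    (hP : P ∈ D.alive n) (he : n₀ ≤ D.entry P n) :
    D.cap B P n ≤ 2 * (D.entry P n : ℝ) * ((D.entry P n : ℝ) ^ β + b₁ * D.entry P n) +
      B * (D.entry P n : ℝ) ^ 2 * Real.log ((n : ℝ) + 2) := by
  have hg : (D.deg P : ℝ) ≤ D.entry P n := D.deg_le_entry hW hB hP he
  have hL : D.logHt P ≤ (D.entry P n : ℝ) ^ β + b₁ * D.entry P n :=
    D.logHt_le_entry hW hB hP he
  have hg0 : (0 : ℝ) ≤ D.deg P := by positivity
  have hL0 : 0 ≤ D.logHt P := hW.2.1 P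
  have he0 : (0 : ℝ) ≤ D.entry P n := by positivity
  have hn0 : (0 : ℝ) ≤ n := by positivity
  have hlog : 0 ≤ Real.log ((n : ℝ) + 2) := Real.log_nonneg (by linarith)
  have h1 : (D.deg P : ℝ) * D.logHt P ≤
      (D.entry P n : ℝ) * ((D.entry P n : ℝ) ^ β + b₁ * D.entry P n) :=
    mul_le_mul hg hL hL0 he0
  have h2 : (D.deg P : ℝ) ^ 2 ≤ (D.entry P n : ℝ) ^ 2 := pow_le_pow_left₀ hg0 hg 2
  unfold cap
  nlinarith [mul_le_mul_of_nonneg_right (mul_le_mul_of_nonneg_left h2 hBnn) hlog]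

/-! ### Pen §5: the entry law at the level `ℓ = e - 1` before the entry -/

/-- Assigned active columns of a level `ℓ` (`1 ≤ k ≤ ℓ^σ`, `0 < σ ≤ 1`) are at most `ℓ`
in number. -/
theorem card_le_of_active {σ : ℝ} (hσ : 0 < σ) (hσ1 : σ ≤ 1) {ℓ : ℕ} (S : Finset ℕ)
    (hS : ∀ k ∈ S, 1 ≤ k ∧ (k : ℝ) ≤ (ℓ : ℝ) ^ σ) : S.card ≤ ℓ := by
  have hsub : S ⊆ Finset.Icc 1 ℓ := by
    intro k hk
    obtain ⟨hk1, hk2⟩ := hS k hk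
    rw [Finset.mem_Icc]
    refine ⟨hk1, ?_⟩
    rcases Nat.eq_zero_or_pos ℓ with hℓ | hℓ
    · subst hℓ
      have : (k : ℝ) ≤ 0 := by simpa [Real.zero_rpow hσ.ne'] using hk2
      have : (1 : ℝ) ≤ k := by exact_mod_cast hk1
      linarith
    · have hℓ1 : (1 : ℝ) ≤ ℓ := by exact_mod_cast hℓ
      have : (ℓ : ℝ) ^ σ ≤ (ℓ : ℝ) ^ (1 : ℝ) := Real.rpow_le_rpow_of_exponent_le hℓ1 hσ1
      rw [Real.rpow_one] at this
      exact_mod_cast hk2.trans this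
  calc S.card ≤ (Finset.Icc 1 ℓ).card := Finset.card_le_card hsub
    _ = ℓ := by simp

/-- (L1) at the level `ℓ` before the entry (`entry P n = ℓ + 1`, `ℓ ≥ n₀`), for assigned
columns `S ⊆ [1, ℓ^σ]`: `Σ_{k∈S} min (d_P^k, ℓ^ν) ≤ C_P(ℓ) + A₂ (ℓ + g_P + |S|)² log (ℓ+2)`. -/
theorem entryLaw_pred_entry {β σ ν A₂ : ℝ} {n₀ : ℕ} (hE : D ∈ entryLaw β σ ν A₂ n₀)
    {P : ι} {n ℓ : ℕ} (hℓ : D.entry P n = ℓ + 1) (hℓ0 : n₀ ≤ ℓ) (S : Finset ℕ)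
    (hS : ∀ k ∈ S, 1 ≤ k ∧ (k : ℝ) ≤ (ℓ : ℝ) ^ σ) :
    (∑ k ∈ S, min (D.bank P k) ((ℓ : ℝ) ^ ν)) ≤
      D.cost β P ℓ + A₂ * ((ℓ : ℝ) + D.deg P + S.card) ^ 2 * Real.log ((ℓ : ℝ) + 2) := by
  have hna : P ∉ D.alive ℓ := by
    have := D.not_alive_pred_entry P n (by omega)
    rwa [hℓ, Nat.add_sub_cancel] at this
  exact hE P ℓ hℓ0 hna S hS

/-- Explicit size of the (L1) error before the entry (DESIGN §2 (§5)): with `g_P ≤ ℓ + 1`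
(degree budget at the entry level) and `|S| ≤ ℓ` (active columns), for `ℓ ≥ 1`,
`A₂ (ℓ + g_P + |S|)² log (ℓ+2) ≤ 16 A₂ ℓ² log (ℓ+2)`. -/
theorem entry_error_le {c₀ β b₁ σ A₂ : ℝ} {n₀ : ℕ} (hW : D ∈ wellFormed c₀)
    (hB : D ∈ budgetLaw β b₁ n₀) (hA₂ : 0 ≤ A₂) (hσ : 0 < σ) (hσ1 : σ ≤ 1) {P : ι}
    {n ℓ : ℕ} (hP : P ∈ D.alive n) (hℓ : D.entry P n = ℓ + 1) (hℓ0 : n₀ ≤ ℓ)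
    (hℓ1 : 1 ≤ ℓ) (S : Finset ℕ) (hS : ∀ k ∈ S, 1 ≤ k ∧ (k : ℝ) ≤ (ℓ : ℝ) ^ σ) :
    A₂ * ((ℓ : ℝ) + D.deg P + S.card) ^ 2 * Real.log ((ℓ : ℝ) + 2) ≤
      16 * A₂ * (ℓ : ℝ) ^ 2 * Real.log ((ℓ : ℝ) + 2) := by
  have hg : (D.deg P : ℝ) ≤ D.entry P n := D.deg_le_entry hW hB hP (by omega)
  have hg' : (D.deg P : ℝ) ≤ (ℓ : ℝ) + 1 := by rw [hℓ] at hg; push_cast at hg; exact hg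
  have hc : (S.card : ℝ) ≤ ℓ := by exact_mod_cast card_le_of_active hσ hσ1 S hS
  have hℓ1' : (1 : ℝ) ≤ ℓ := by exact_mod_cast hℓ1
  have hsum0 : (0 : ℝ) ≤ (ℓ : ℝ) + D.deg P + S.card := by positivity
  have hsum : (ℓ : ℝ) + D.deg P + S.card ≤ 4 * ℓ := by linarith
  have hsq : ((ℓ : ℝ) + D.deg P + S.card) ^ 2 ≤ (4 * ℓ) ^ 2 := pow_le_pow_left₀ hsum0 hsum 2
  have hlog : 0 ≤ Real.log ((ℓ : ℝ) + 2) := Real.log_nonneg (by linarith)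
  nlinarith [mul_le_mul_of_nonneg_right (mul_le_mul_of_nonneg_left hsq hA₂) hlog]

/-- The (L1) right-hand side before the entry is at most `(1 + ε(ℓ)) C_P(ℓ)` with
`ε(ℓ) = 16 A₂ ℓ^{2-β} log (ℓ+2)` (since `C_P(ℓ) ≥ ℓ^β`); `ε(ℓ) → 0` when `β > 2`. -/
theorem entry_error_le' {c₀ β b₁ σ A₂ : ℝ} {n₀ : ℕ} (hW : D ∈ wellFormed c₀)
    (hB : D ∈ budgetLaw β b₁ n₀) (hA₂ : 0 ≤ A₂) (hσ : 0 < σ) (hσ1 : σ ≤ 1) {P : ι}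
    {n ℓ : ℕ} (hP : P ∈ D.alive n) (hℓ : D.entry P n = ℓ + 1) (hℓ0 : n₀ ≤ ℓ)
    (hℓ1 : 1 ≤ ℓ) (S : Finset ℕ) (hS : ∀ k ∈ S, 1 ≤ k ∧ (k : ℝ) ≤ (ℓ : ℝ) ^ σ) :
    D.cost β P ℓ + A₂ * ((ℓ : ℝ) + D.deg P + S.card) ^ 2 * Real.log ((ℓ : ℝ) + 2) ≤
      (1 + 16 * A₂ * (ℓ : ℝ) ^ (2 - β) * Real.log ((ℓ : ℝ) + 2)) * D.cost β P ℓ := by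
  have h1 := D.entry_error_le hW hB hA₂ hσ hσ1 hP hℓ hℓ0 hℓ1 S hS
  have hcost : (ℓ : ℝ) ^ β ≤ D.cost β P ℓ := D.rpow_le_cost hW β P ℓ
  have hℓpos : (0 : ℝ) < ℓ := by exact_mod_cast hℓ1
  have hsplit : (ℓ : ℝ) ^ 2 = (ℓ : ℝ) ^ (2 - β) * (ℓ : ℝ) ^ β := by
    rw [← Real.rpow_add hℓpos]; norm_num
  have hlog : 0 ≤ Real.log ((ℓ : ℝ) + 2) := Real.log_nonneg (by linarith)
  have hfac : 0 ≤ 16 * A₂ * (ℓ : ℝ) ^ (2 - β) * Real.log ((ℓ : ℝ) + 2) := by positivity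
  have h2 : 16 * A₂ * (ℓ : ℝ) ^ 2 * Real.log ((ℓ : ℝ) + 2) ≤
      16 * A₂ * (ℓ : ℝ) ^ (2 - β) * Real.log ((ℓ : ℝ) + 2) * D.cost β P ℓ := by
    rw [hsplit]
    have := mul_le_mul_of_nonneg_left hcost hfac
    nlinarith
  nlinarith

/-- Pen §5 (a') (shallow server: `λ n^ν ≤ m ℓ^ν`): every assigned column contributes at
least `λ n^ν / m` to the (L1) sum, so `|S| λ n^ν ≤ m T` for any bound `T` of the (L1)
right-hand side. -/
theorem shallow_card_bound {β σ ν A₂ : ℝ} {n₀ : ℕ} (hE : D ∈ entryLaw β σ ν A₂ n₀)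
    {P : ι} {n ℓ : ℕ} (hℓ : D.entry P n = ℓ + 1) (hℓ0 : n₀ ≤ ℓ) (S : Finset ℕ)
    (hS : ∀ k ∈ S, 1 ≤ k ∧ (k : ℝ) ≤ (ℓ : ℝ) ^ σ) {lam : ℝ}
    (hm : (0 : ℝ) < D.mult P n)
    (hsrv : ∀ k ∈ S, lam * (n : ℝ) ^ ν ≤ D.mult P n * D.bank P k)
    (hshallow : lam * (n : ℝ) ^ ν ≤ D.mult P n * (ℓ : ℝ) ^ ν) {T : ℝ}
    (hT : D.cost β P ℓ + A₂ * ((ℓ : ℝ) + D.deg P + S.card) ^ 2 * Real.log ((ℓ : ℝ) + 2)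
      ≤ T) :
    (S.card : ℝ) * (lam * (n : ℝ) ^ ν) ≤ D.mult P n * T := by
  have hL1 := (D.entryLaw_pred_entry hE hℓ hℓ0 S hS).trans hT
  have hmin : ∀ k ∈ S, lam * (n : ℝ) ^ ν / D.mult P n ≤ min (D.bank P k) ((ℓ : ℝ) ^ ν) := by
    intro k hk
    refine le_min ?_ ?_
    · rw [div_le_iff₀ hm]; linarith [hsrv k hk]
    · rw [div_le_iff₀ hm]; linarith
  have hsum : (S.card : ℝ) * (lam * (n : ℝ) ^ ν / D.mult P n) ≤
      ∑ k ∈ S, min (D.bank P k) ((ℓ : ℝ) ^ ν) := by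
    have := Finset.card_nsmul_le_sum S (fun k => min (D.bank P k) ((ℓ : ℝ) ^ ν)) _ hmin
    simpa [nsmul_eq_mul] using this
  have h := hsum.trans hL1
  have : (S.card : ℝ) * (lam * (n : ℝ) ^ ν / D.mult P n) * D.mult P n ≤ T * D.mult P n :=
    mul_le_mul_of_nonneg_right h hm.le
  calc (S.card : ℝ) * (lam * (n : ℝ) ^ ν)
        = (S.card : ℝ) * (lam * (n : ℝ) ^ ν / D.mult P n) * D.mult P n := by
          field_simp
    _ ≤ T * D.mult P n := this
    _ = D.mult P n * T := by ring

/-- Pen §5 (b') (server deep at entry: `m ℓ^ν ≤ λ n^ν`): every assigned column has bank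
`≥ ℓ^ν`, so (L1) bounds their number: `|S| ℓ^ν ≤ T` (the per-level SUPPLY bound
`s ≤ s^H_P = T / Req_{e-1}`). -/
theorem supply_bound {β σ ν A₂ : ℝ} {n₀ : ℕ} (hE : D ∈ entryLaw β σ ν A₂ n₀)
    {P : ι} {n ℓ : ℕ} (hℓ : D.entry P n = ℓ + 1) (hℓ0 : n₀ ≤ ℓ) (S : Finset ℕ)
    (hS : ∀ k ∈ S, 1 ≤ k ∧ (k : ℝ) ≤ (ℓ : ℝ) ^ σ) {lam : ℝ}
    (hm : (0 : ℝ) < D.mult P n)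
    (hsrv : ∀ k ∈ S, lam * (n : ℝ) ^ ν ≤ D.mult P n * D.bank P k)
    (hdeep : D.mult P n * (ℓ : ℝ) ^ ν ≤ lam * (n : ℝ) ^ ν) {T : ℝ}
    (hT : D.cost β P ℓ + A₂ * ((ℓ : ℝ) + D.deg P + S.card) ^ 2 * Real.log ((ℓ : ℝ) + 2)
      ≤ T) :
    (S.card : ℝ) * (ℓ : ℝ) ^ ν ≤ T := by
  have hL1 := (D.entryLaw_pred_entry hE hℓ hℓ0 S hS).trans hT
  have hmin : ∀ k ∈ S, (ℓ : ℝ) ^ ν ≤ min (D.bank P k) ((ℓ : ℝ) ^ ν) := by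
    intro k hk
    refine le_min ?_ le_rfl
    have h := hdeep.trans (hsrv k hk)
    exact le_of_mul_le_mul_left h hm
  have hsum : (S.card : ℝ) * (ℓ : ℝ) ^ ν ≤ ∑ k ∈ S, min (D.bank P k) ((ℓ : ℝ) ^ ν) := by
    have := Finset.card_nsmul_le_sum S (fun k => min (D.bank P k) ((ℓ : ℝ) ^ ν)) _ hmin
    simpa [nsmul_eq_mul] using this
  exact hsum.trans hL1

/-- Pen §5, "cheap ⇒ (b')": a CHEAP server (`m C_P(n) ≤ η n^ν |S|`, fare `≤ η`) with
`η t < λ`, whose (L1) right-hand side is `≤ t C_P(n)` (via `T ≤ t C_P(ℓ)` and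
monotonicity of the cost), cannot be shallow: `m ℓ^ν < λ n^ν`. -/
theorem deep_of_cheap {β σ ν A₂ : ℝ} {n₀ : ℕ} (hE : D ∈ entryLaw β σ ν A₂ n₀)
    {P : ι} {n ℓ : ℕ} (hℓ : D.entry P n = ℓ + 1) (hℓ0 : n₀ ≤ ℓ) (hn : 1 ≤ n)
    (S : Finset ℕ) (hSne : S.Nonempty) (hS : ∀ k ∈ S, 1 ≤ k ∧ (k : ℝ) ≤ (ℓ : ℝ) ^ σ)
    {lam η t : ℝ} (ht : 0 ≤ t) (hηt : η * t < lam) (hm : (0 : ℝ) < D.mult P n)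
    (hsrv : ∀ k ∈ S, lam * (n : ℝ) ^ ν ≤ D.mult P n * D.bank P k) {T : ℝ}
    (hT : D.cost β P ℓ + A₂ * ((ℓ : ℝ) + D.deg P + S.card) ^ 2 * Real.log ((ℓ : ℝ) + 2)
      ≤ T) (hTn : T ≤ t * D.cost β P n)
    (hcheap : (D.mult P n : ℝ) * D.cost β P n ≤ η * (n : ℝ) ^ ν * S.card) :
    D.mult P n * (ℓ : ℝ) ^ ν < lam * (n : ℝ) ^ ν := by
  by_contra hsh
  push Not at hsh
  have h1 := D.shallow_card_bound hE hℓ hℓ0 S hS hm hsrv hsh hT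
  have hcard : (0 : ℝ) < S.card := by exact_mod_cast hSne.card_pos
  have hnν : (0 : ℝ) < (n : ℝ) ^ ν := Real.rpow_pos_of_pos (by exact_mod_cast hn) ν
  have h2 : (D.mult P n : ℝ) * T ≤ t * ((D.mult P n : ℝ) * D.cost β P n) := by
    have := mul_le_mul_of_nonneg_left hTn hm.le
    linarith
  have h3 : t * ((D.mult P n : ℝ) * D.cost β P n) ≤ t * (η * (n : ℝ) ^ ν * S.card) :=
    mul_le_mul_of_nonneg_left hcheap ht
  have h4 : (S.card : ℝ) * (lam * (n : ℝ) ^ ν) ≤ t * (η * (n : ℝ) ^ ν * S.card) :=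
    h1.trans (h2.trans h3)
  have h5 : (S.card : ℝ) * (n : ℝ) ^ ν * (lam - η * t) ≤ 0 := by nlinarith
  have h6 : 0 < (S.card : ℝ) * (n : ℝ) ^ ν * (lam - η * t) :=
    mul_pos (mul_pos hcard hnν) (by linarith)
  linarith

end SoloServiceData

end Summit.Schanuel.Schanuel.Theorems
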